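import Summits.NavierStokesRegularity.FunctionalMining.NoGo.MiddleEigenvalueKillAllLift
import Summits.NavierStokesRegularity.FunctionalMining.NoGo.MiddleEigenvalueKillAllProfiles
import Summits.NavierStokesRegularity.FunctionalMining.NoGo.MiddleEigenvalueKit
import Mathlib.Analysis.Calculus.BumpFunction.InnerProduct
import Mathlib.Analysis.Calculus.LocalExtr.Basic
import Mathlib.MeasureTheory.Integral.IntegralEqImproper
import Mathlib.MeasureTheory.Measure.Haar.NormedSpace
import HarnessLib

/-!
# K1-Q2 kill-all witness, part 3/4: the field, its Jacobian, `div = 0`, `det S ≡ 0`, `λ₂ ≡ 0`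

Search for candidate a priori estimates; no regularity claim. NS FUNCTIONAL MINING — NO-GO BRANCH
(cell `pub-nsfunc`, no-go seat gen 7).
In cube coordinates `y ∈ [0,1)³`, `p = y₀ - ½`, `q = y₁ - ½`, `s = p² + q²`:
`G(y) = ( -q·gc(s)·Vz(y₂),  p·gc(s)·Vz(y₂),  A(p)·A(2q) )`, a vertically modulated solid-body rotation
cut off radially, plus a vertical jet supported inside the core `{gc = 1}`; the witness on `T³` is
`fld ξ = G (repr ξ)` (vertical lift). Proved: `fld` is smooth (`isSmooth_fld`) and divergence free
(`isDivFree_fld`); its Jacobian in closed form (`partialDeriv_fld`); the strain has trace `0` and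
`det S ≡ 0` (`strain_det`: in the jet region the horizontal part is an exact rotation, elsewhere a jet
profile and its derivative vanish), hence the middle eigenvalue vanishes identically
(`middle_eq_zero`, via `MiddleEigen.middle_eq_zero_of_det_eq_zero`).
Nothing is asserted about Navier–Stokes regularity.
-/

noncomputable section

open MeasureTheory Set Function Filter Topology Metric
open scoped ContDiff Real

namespace Summit.NavierStokesRegularity.FunctionalMining

namespace KillAll

open Literature.Analysis.FunctionSpaces Literature.Analysis.FunctionSpaces.Torus

/-! ## The witness field on `ℝ³`

In cube coordinates `y`, with `p = y₀ - 1/2`, `q = y₁ - 1/2`, `s = p² + q²`: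
`G(y) = ( -q gc(s) Vz(y₂),  p gc(s) Vz(y₂),  A(p) A(2q) )` — a vertically modulated solid-body
rotation (cut off radially) plus a vertical jet supported in the core `{gc = 1}`. -/

/-- The shift to cube-centred coordinates `t ↦ t - 1/2`. -/
def sh (t : ℝ) : ℝ := t - 1 / 2

/-- `p = y₀ - 1/2`. -/
def pc (y : E3) : ℝ := sh (y 0)

/-- `q = y₁ - 1/2`. -/
def qc (y : E3) : ℝ := sh (y 1)

/-- `s = p² + q²`. -/
def rs (y : E3) : ℝ := pc y * pc y + qc y * qc y

/-- First component `-q gc(s) Vz(y₂)`. -/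
def U0 (y : E3) : ℝ := -(qc y * gc (rs y) * Vz (y 2))

/-- Second component `p gc(s) Vz(y₂)`. -/
def U1 (y : E3) : ℝ := pc y * gc (rs y) * Vz (y 2)

/-- Third component (the jet) `A(p) A(2q)`. -/
def U2 (y : E3) : ℝ := A (pc y) * A (2 * qc y)

/-- The three components. -/
def U : Fin 3 → E3 → ℝ := ![U0, U1, U2]

/-- The witness field in cube coordinates. -/
def G : E3 → E3 := Sep3.vec3 U

/-- **The witness field on `T³`.** -/
def fld (ξ : UnitAddTorus (Fin 3)) : E3 := G (repr ξ)

/-- Auxiliary declaration `U_zero` of the swirl–jet witness field (file 3/6) (NOGO N11 kill-all chain; search for candidate a priori estimates; no regularity claim). -/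
@[simp] theorem U_zero : U 0 = U0 := rfl
/-- Auxiliary declaration `U_one` of the swirl–jet witness field (file 3/6) (NOGO N11 kill-all chain; search for candidate a priori estimates; no regularity claim). -/
@[simp] theorem U_one : U 1 = U1 := rfl
/-- Auxiliary declaration `U_two` of the swirl–jet witness field (file 3/6) (NOGO N11 kill-all chain; search for candidate a priori estimates; no regularity claim). -/
@[simp] theorem U_two : U 2 = U2 := rfl

/-! ### Smoothness -/

/-- Auxiliary declaration `contDiff_coord` of the swirl–jet witness field (file 3/6) (NOGO N11 kill-all chain; search for candidate a priori estimates; no regularity claim). -/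
private theorem contDiff_coord (a : Fin 3) : ContDiff ℝ ∞ (fun y : E3 => y a) :=
  (EuclideanSpace.proj a : E3 →L[ℝ] ℝ).contDiff

/-- Auxiliary declaration `contDiff_sh` of the swirl–jet witness field (file 3/6) (NOGO N11 kill-all chain; search for candidate a priori estimates; no regularity claim). -/
theorem contDiff_sh : ContDiff ℝ ∞ sh := contDiff_id.sub contDiff_const

/-- Auxiliary declaration `contDiff_pc` of the swirl–jet witness field (file 3/6) (NOGO N11 kill-all chain; search for candidate a priori estimates; no regularity claim). -/
theorem contDiff_pc : ContDiff ℝ ∞ pc := contDiff_sh.comp (contDiff_coord 0)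

/-- Auxiliary declaration `contDiff_qc` of the swirl–jet witness field (file 3/6) (NOGO N11 kill-all chain; search for candidate a priori estimates; no regularity claim). -/
theorem contDiff_qc : ContDiff ℝ ∞ qc := contDiff_sh.comp (contDiff_coord 1)

/-- Auxiliary declaration `contDiff_rs` of the swirl–jet witness field (file 3/6) (NOGO N11 kill-all chain; search for candidate a priori estimates; no regularity claim). -/
theorem contDiff_rs : ContDiff ℝ ∞ rs :=
  (contDiff_pc.mul contDiff_pc).add (contDiff_qc.mul contDiff_qc)

/-- Auxiliary declaration `contDiff_U0` of the swirl–jet witness field (file 3/6) (NOGO N11 kill-all chain; search for candidate a priori estimates; no regularity claim). -/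
theorem contDiff_U0 : ContDiff ℝ ∞ U0 :=
  ((contDiff_qc.mul (contDiff_gc.comp contDiff_rs)).mul (contDiff_Vz.comp (contDiff_coord 2))).neg

/-- Auxiliary declaration `contDiff_U1` of the swirl–jet witness field (file 3/6) (NOGO N11 kill-all chain; search for candidate a priori estimates; no regularity claim). -/
theorem contDiff_U1 : ContDiff ℝ ∞ U1 :=
  (contDiff_pc.mul (contDiff_gc.comp contDiff_rs)).mul (contDiff_Vz.comp (contDiff_coord 2))

/-- Auxiliary declaration `contDiff_U2` of the swirl–jet witness field (file 3/6) (NOGO N11 kill-all chain; search for candidate a priori estimates; no regularity claim). -/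
theorem contDiff_U2 : ContDiff ℝ ∞ U2 :=
  (contDiff_A.comp contDiff_pc).mul (contDiff_A.comp (contDiff_const.mul contDiff_qc))

/-- Auxiliary declaration `contDiff_U` of the swirl–jet witness field (file 3/6) (NOGO N11 kill-all chain; search for candidate a priori estimates; no regularity claim). -/
theorem contDiff_U (i : Fin 3) : ContDiff ℝ ∞ (U i) := by
  fin_cases i
  · exact contDiff_U0
  · exact contDiff_U1
  · exact contDiff_U2

/-- Auxiliary declaration `differentiable_U` of the swirl–jet witness field (file 3/6) (NOGO N11 kill-all chain; search for candidate a priori estimates; no regularity claim). -/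
theorem differentiable_U (i : Fin 3) : Differentiable ℝ (U i) :=
  (contDiff_U i).differentiable (by simp)

/-- Auxiliary declaration `contDiff_G` of the swirl–jet witness field (file 3/6) (NOGO N11 kill-all chain; search for candidate a priori estimates; no regularity claim). -/
private theorem contDiff_G : ContDiff ℝ ∞ G := Sep3.contDiff_vec3 contDiff_U

/-! ### Vertical periodicity and vanishing near the vertical faces -/

/-- Auxiliary declaration `add_e2_apply0` of the swirl–jet witness field (file 3/6) (NOGO N11 kill-all chain; search for candidate a priori estimates; no regularity claim). -/
private theorem add_e2_apply0 (y : E3) : (y + EuclideanSpace.single 2 1 : E3) 0 = y 0 := by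
  simp

/-- Auxiliary declaration `add_e2_apply1` of the swirl–jet witness field (file 3/6) (NOGO N11 kill-all chain; search for candidate a priori estimates; no regularity claim). -/
private theorem add_e2_apply1 (y : E3) : (y + EuclideanSpace.single 2 1 : E3) 1 = y 1 := by
  simp

/-- Auxiliary declaration `add_e2_apply2` of the swirl–jet witness field (file 3/6) (NOGO N11 kill-all chain; search for candidate a priori estimates; no regularity claim). -/
private theorem add_e2_apply2 (y : E3) : (y + EuclideanSpace.single 2 1 : E3) 2 = y 2 + 1 := by
  simp

/-- Auxiliary declaration `pc_add_e2` of the swirl–jet witness field (file 3/6) (NOGO N11 kill-all chain; search for candidate a priori estimates; no regularity claim). -/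
theorem pc_add_e2 (y : E3) : pc (y + EuclideanSpace.single 2 1) = pc y := by
  simp only [pc, add_e2_apply0]

/-- Auxiliary declaration `qc_add_e2` of the swirl–jet witness field (file 3/6) (NOGO N11 kill-all chain; search for candidate a priori estimates; no regularity claim). -/
theorem qc_add_e2 (y : E3) : qc (y + EuclideanSpace.single 2 1) = qc y := by
  simp only [qc, add_e2_apply1]

/-- Auxiliary declaration `rs_add_e2` of the swirl–jet witness field (file 3/6) (NOGO N11 kill-all chain; search for candidate a priori estimates; no regularity claim). -/
theorem rs_add_e2 (y : E3) : rs (y + EuclideanSpace.single 2 1) = rs y := by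
  simp only [rs, pc_add_e2, qc_add_e2]

/-- Auxiliary declaration `U_add_e2` of the swirl–jet witness field (file 3/6) (NOGO N11 kill-all chain; search for candidate a priori estimates; no regularity claim). -/
theorem U_add_e2 (i : Fin 3) (y : E3) : U i (y + EuclideanSpace.single 2 1) = U i y := by
  fin_cases i
  · show U0 _ = U0 y
    simp only [U0, qc_add_e2, rs_add_e2, add_e2_apply2, Vz_add_one]
  · show U1 _ = U1 y
    simp only [U1, pc_add_e2, rs_add_e2, add_e2_apply2, Vz_add_one]
  · show U2 _ = U2 y
    simp only [U2, pc_add_e2, qc_add_e2]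

/-- Auxiliary declaration `G_add_e2` of the swirl–jet witness field (file 3/6) (NOGO N11 kill-all chain; search for candidate a priori estimates; no regularity claim). -/
theorem G_add_e2 (y : E3) : G (y + EuclideanSpace.single 2 1) = G y := by
  ext i
  simp only [G, Sep3.vec3_apply, U_add_e2]

/-- Near the vertical faces (`y₀` or `y₁` within `1/64` of `0` or `1`) the radius is large:
`s ≥ 7/32`, so the cut-off vanishes. -/
theorem gc_rs_eq_zero {y : E3}
    (h : y 0 ≤ 1 / 64 ∨ 1 - 1 / 64 ≤ y 0 ∨ y 1 ≤ 1 / 64 ∨ 1 - 1 / 64 ≤ y 1) : gc (rs y) = 0 := by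
  apply gc_eq_zero
  have hnn : 0 ≤ rs y := by unfold rs; nlinarith [sq_nonneg (pc y), sq_nonneg (qc y)]
  rw [abs_of_nonneg hnn]
  unfold rs pc qc sh
  rcases h with h | h | h | h <;> nlinarith [sq_nonneg (y 0 - 1 / 2), sq_nonneg (y 1 - 1 / 2)]

/-- Auxiliary declaration `A_pc_eq_zero` of the swirl–jet witness field (file 3/6) (NOGO N11 kill-all chain; search for candidate a priori estimates; no regularity claim). -/
theorem A_pc_eq_zero {y : E3} (h : y 0 ≤ 1 / 64 ∨ 1 - 1 / 64 ≤ y 0) : A (pc y) = 0 := by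
  rcases h with h | h
  · exact A_eq_zero_of_nonpos (by unfold pc sh; linarith)
  · exact A_eq_zero_of_ge (by unfold pc sh; linarith)

/-- Auxiliary declaration `A_qc_eq_zero` of the swirl–jet witness field (file 3/6) (NOGO N11 kill-all chain; search for candidate a priori estimates; no regularity claim). -/
theorem A_qc_eq_zero {y : E3} (h : y 1 ≤ 1 / 64 ∨ 1 - 1 / 64 ≤ y 1) : A (2 * qc y) = 0 := by
  rcases h with h | h
  · exact A_eq_zero_of_nonpos (by unfold qc sh; linarith)
  · exact A_eq_zero_of_ge (by unfold qc sh; linarith)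

/-- Auxiliary declaration `U_eq_zero_near_faces` of the swirl–jet witness field (file 3/6) (NOGO N11 kill-all chain; search for candidate a priori estimates; no regularity claim). -/
theorem U_eq_zero_near_faces (i : Fin 3) (y : E3)
    (h : y 0 ≤ 1 / 64 ∨ 1 - 1 / 64 ≤ y 0 ∨ y 1 ≤ 1 / 64 ∨ 1 - 1 / 64 ≤ y 1) : U i y = 0 := by
  fin_cases i
  · show U0 y = 0
    simp [U0, gc_rs_eq_zero h]
  · show U1 y = 0
    simp [U1, gc_rs_eq_zero h]
  · show U2 y = 0
    unfold U2
    rcases h with h | h | h | h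
    · rw [A_pc_eq_zero (Or.inl h), zero_mul]
    · rw [A_pc_eq_zero (Or.inr h), zero_mul]
    · rw [A_qc_eq_zero (Or.inl h), mul_zero]
    · rw [A_qc_eq_zero (Or.inr h), mul_zero]

/-- Auxiliary declaration `G_eq_zero_near_faces` of the swirl–jet witness field (file 3/6) (NOGO N11 kill-all chain; search for candidate a priori estimates; no regularity claim). -/
theorem G_eq_zero_near_faces (y : E3)
    (h : y 0 ≤ 1 / 64 ∨ 1 - 1 / 64 ≤ y 0 ∨ y 1 ≤ 1 / 64 ∨ 1 - 1 / 64 ≤ y 1) : G y = 0 := by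
  ext i
  simp only [G, Sep3.vec3_apply, U_eq_zero_near_faces i y h]
  rfl

/-- **The witness field is smooth on `T³`.** -/
theorem isSmooth_fld : IsSmooth fld :=
  isSmooth_comp_repr contDiff_G G_add_e2 (by norm_num : (0 : ℝ) < 1 / 64) G_eq_zero_near_faces

/-! ### The Jacobian in closed form -/

/-- Auxiliary declaration `proj_apply'` of the swirl–jet witness field (file 3/6) (NOGO N11 kill-all chain; search for candidate a priori estimates; no regularity claim). -/
private theorem proj_apply' (a : Fin 3) (v : E3) : (EuclideanSpace.proj a : E3 →L[ℝ] ℝ) v = v a :=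
  rfl

/-- Auxiliary declaration `hasFDerivAt_pc` of the swirl–jet witness field (file 3/6) (NOGO N11 kill-all chain; search for candidate a priori estimates; no regularity claim). -/
theorem hasFDerivAt_pc (y : E3) : HasFDerivAt pc (EuclideanSpace.proj 0 : E3 →L[ℝ] ℝ) y :=
  ((EuclideanSpace.proj 0 : E3 →L[ℝ] ℝ).hasFDerivAt).sub_const (1 / 2)

/-- Auxiliary declaration `hasFDerivAt_qc` of the swirl–jet witness field (file 3/6) (NOGO N11 kill-all chain; search for candidate a priori estimates; no regularity claim). -/
theorem hasFDerivAt_qc (y : E3) : HasFDerivAt qc (EuclideanSpace.proj 1 : E3 →L[ℝ] ℝ) y :=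
  ((EuclideanSpace.proj 1 : E3 →L[ℝ] ℝ).hasFDerivAt).sub_const (1 / 2)

/-- Auxiliary declaration `hasFDerivAt_rs` of the swirl–jet witness field (file 3/6) (NOGO N11 kill-all chain; search for candidate a priori estimates; no regularity claim). -/
theorem hasFDerivAt_rs (y : E3) : HasFDerivAt rs
    (pc y • (EuclideanSpace.proj 0 : E3 →L[ℝ] ℝ) + pc y • (EuclideanSpace.proj 0 : E3 →L[ℝ] ℝ) +
      (qc y • (EuclideanSpace.proj 1 : E3 →L[ℝ] ℝ) + qc y • (EuclideanSpace.proj 1 : E3 →L[ℝ] ℝ)))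
    y :=
  ((hasFDerivAt_pc y).mul (hasFDerivAt_pc y)).add ((hasFDerivAt_qc y).mul (hasFDerivAt_qc y))

/-- Auxiliary declaration `hasFDerivAt_gc_rs` of the swirl–jet witness field (file 3/6) (NOGO N11 kill-all chain; search for candidate a priori estimates; no regularity claim). -/
theorem hasFDerivAt_gc_rs (y : E3) : HasFDerivAt (fun y => gc (rs y))
    (deriv gc (rs y) • (pc y • (EuclideanSpace.proj 0 : E3 →L[ℝ] ℝ) +
      pc y • (EuclideanSpace.proj 0 : E3 →L[ℝ] ℝ) +
      (qc y • (EuclideanSpace.proj 1 : E3 →L[ℝ] ℝ) + qc y • (EuclideanSpace.proj 1 : E3 →L[ℝ] ℝ))))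
    y :=
  (differentiable_gc _).hasDerivAt.comp_hasFDerivAt y (hasFDerivAt_rs y)

/-- Auxiliary declaration `hasFDerivAt_V2` of the swirl–jet witness field (file 3/6) (NOGO N11 kill-all chain; search for candidate a priori estimates; no regularity claim). -/
theorem hasFDerivAt_V2 (y : E3) :
    HasFDerivAt (fun y : E3 => Vz (y 2)) (dVz (y 2) • (EuclideanSpace.proj 2 : E3 →L[ℝ] ℝ)) y := by
  have h2 : HasFDerivAt (fun y : E3 => y 2) (EuclideanSpace.proj 2 : E3 →L[ℝ] ℝ) y :=
    (EuclideanSpace.proj 2 : E3 →L[ℝ] ℝ).hasFDerivAt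
  have h := (hasDerivAt_Vz (y 2)).comp_hasFDerivAt y h2
  exact h

/-- Auxiliary declaration `hasFDerivAt_A_pc` of the swirl–jet witness field (file 3/6) (NOGO N11 kill-all chain; search for candidate a priori estimates; no regularity claim). -/
theorem hasFDerivAt_A_pc (y : E3) :
    HasFDerivAt (fun y : E3 => A (pc y)) (deriv A (pc y) • (EuclideanSpace.proj 0 : E3 →L[ℝ] ℝ)) y :=
  (differentiable_A _).hasDerivAt.comp_hasFDerivAt y (hasFDerivAt_pc y)

/-- Auxiliary declaration `hasFDerivAt_A_qc` of the swirl–jet witness field (file 3/6) (NOGO N11 kill-all chain; search for candidate a priori estimates; no regularity claim). -/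
theorem hasFDerivAt_A_qc (y : E3) :
    HasFDerivAt (fun y : E3 => A (2 * qc y))
      (deriv A (2 * qc y) • ((2 : ℝ) • (EuclideanSpace.proj 1 : E3 →L[ℝ] ℝ))) y :=
  (differentiable_A _).hasDerivAt.comp_hasFDerivAt y ((hasFDerivAt_qc y).const_mul 2)

/-- `DU₀(y) v`. -/
theorem fderiv_U0 (y v : E3) : fderiv ℝ U0 y v =
    -(v 0 * (qc y * (deriv gc (rs y) * (2 * pc y)) * Vz (y 2))
      + v 1 * ((gc (rs y) + qc y * (deriv gc (rs y) * (2 * qc y))) * Vz (y 2))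
      + v 2 * (qc y * gc (rs y) * dVz (y 2))) := by
  have h := (((hasFDerivAt_qc y).mul (hasFDerivAt_gc_rs y)).mul (hasFDerivAt_V2 y)).neg
  rw [show U0 = -((qc * fun y => gc (rs y)) * fun y : E3 => Vz (y 2)) from by funext y; rfl,
    h.fderiv]
  simp only [Pi.mul_apply, _root_.neg_apply, _root_.add_apply, _root_.smul_apply, smul_eq_mul,
    proj_apply']
  ring

/-- `DU₁(y) v`. -/
theorem fderiv_U1 (y v : E3) : fderiv ℝ U1 y v =
    v 0 * ((gc (rs y) + pc y * (deriv gc (rs y) * (2 * pc y))) * Vz (y 2))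
      + v 1 * (pc y * (deriv gc (rs y) * (2 * qc y)) * Vz (y 2))
      + v 2 * (pc y * gc (rs y) * dVz (y 2)) := by
  have h := ((hasFDerivAt_pc y).mul (hasFDerivAt_gc_rs y)).mul (hasFDerivAt_V2 y)
  rw [show U1 = ((pc * fun y => gc (rs y)) * fun y : E3 => Vz (y 2)) from by funext y; rfl,
    h.fderiv]
  simp only [Pi.mul_apply, _root_.add_apply, _root_.smul_apply, smul_eq_mul, proj_apply']
  ring

/-- `DU₂(y) v`. -/
theorem fderiv_U2 (y v : E3) : fderiv ℝ U2 y v =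
    v 0 * (deriv A (pc y) * A (2 * qc y)) + v 1 * (A (pc y) * (2 * deriv A (2 * qc y))) := by
  have h := (hasFDerivAt_A_pc y).mul (hasFDerivAt_A_qc y)
  rw [show U2 = ((fun y => A (pc y)) * fun y => A (2 * qc y)) from by funext y; rfl, h.fderiv]
  simp only [_root_.add_apply, _root_.smul_apply, smul_eq_mul, proj_apply']
  ring

/-- The Jacobian `jac y i j = ∂ᵢ Gⱼ (y)` in closed form. -/
def jac (y : E3) : Matrix (Fin 3) (Fin 3) ℝ :=
  !![-(qc y * (deriv gc (rs y) * (2 * pc y)) * Vz (y 2)),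
      (gc (rs y) + pc y * (deriv gc (rs y) * (2 * pc y))) * Vz (y 2),
      deriv A (pc y) * A (2 * qc y);
    -((gc (rs y) + qc y * (deriv gc (rs y) * (2 * qc y))) * Vz (y 2)),
      pc y * (deriv gc (rs y) * (2 * qc y)) * Vz (y 2),
      A (pc y) * (2 * deriv A (2 * qc y));
    -(qc y * gc (rs y) * dVz (y 2)), pc y * gc (rs y) * dVz (y 2), 0]

/-- `DUⱼ(y) eᵢ = jac y i j`. -/
theorem fderiv_U_single (y : E3) (i j : Fin 3) :
    fderiv ℝ (U j) y (EuclideanSpace.single i 1) = jac y i j := by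
  fin_cases i <;> fin_cases j <;>
    simp [fderiv_U0, fderiv_U1, fderiv_U2, jac]

/-- **Partial derivatives of the witness**: `(∂ᵢ fld)(ξ)ⱼ = jac (repr ξ) i j`. -/
theorem partialDeriv_fld (i j : Fin 3) (ξ : UnitAddTorus (Fin 3)) :
    Torus.partialDeriv i fld ξ j = jac (repr ξ) i j := by
  have h := partialDeriv_comp_repr contDiff_G G_add_e2 (by norm_num : (0 : ℝ) < 1 / 64)
    G_eq_zero_near_faces i ξ
  rw [show fld = fun x => G (repr x) from rfl, h, G, Sep3.fderiv_vec3_apply differentiable_U,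
    fderiv_U_single]

/-- Partial derivatives of the components: `∂ᵢ (fld · j)(ξ) = jac (repr ξ) i j`. -/
theorem partialDeriv_fld_apply (i j : Fin 3) (ξ : UnitAddTorus (Fin 3)) :
    Torus.partialDeriv i (fun x => fld x j) ξ = jac (repr ξ) i j := by
  have h := partialDeriv_comp_repr (contDiff_U j) (U_add_e2 j) (by norm_num : (0 : ℝ) < 1 / 64)
    (U_eq_zero_near_faces j) i ξ
  rw [show (fun x => fld x j) = fun x => U j (repr x) from rfl, h, fderiv_U_single]

/-! ### Divergence, strain, middle eigenvalue -/

/-- **The witness is divergence free.** -/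
theorem isDivFree_fld : IsDivFree fld := fun ξ => by
  simp only [Torus.divergence, Fin.sum_univ_three, partialDeriv_fld_apply, jac]
  simp
  ring

/-- In the jet region the cut-off is identically `1`: `gc(s) = 1`, `gc'(s) = 0`. -/
theorem core_of_jet {y : E3} (hp : |pc y - 1 / 4| < 1 / 8) (hq : |2 * qc y - 1 / 4| < 1 / 8) :
    gc (rs y) = 1 ∧ deriv gc (rs y) = 0 := by
  have hs : |rs y| ≤ 3 / 16 := by
    have hnn : 0 ≤ rs y := by unfold rs; nlinarith [sq_nonneg (pc y), sq_nonneg (qc y)]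
    rw [abs_of_nonneg hnn]
    have h1 := abs_lt.1 hp
    have h2 := abs_lt.1 hq
    unfold rs; nlinarith
  exact ⟨gc_eq_one hs, dgc_eq_zero hs⟩

/-- The strain matrix of the witness at `ξ`. -/
def strain (ξ : UnitAddTorus (Fin 3)) : Matrix (Fin 3) (Fin 3) ℝ :=
  Matrix.of fun i j => (Torus.partialDeriv j fld ξ i + Torus.partialDeriv i fld ξ j) / 2

/-- Auxiliary declaration `strain_isSymm` of the swirl–jet witness field (file 3/6) (NOGO N11 kill-all chain; search for candidate a priori estimates; no regularity claim). -/
theorem strain_isSymm (ξ : UnitAddTorus (Fin 3)) : (strain ξ).IsSymm := by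
  ext i j
  simp only [strain, Matrix.transpose_apply, Matrix.of_apply]
  ring

/-- Auxiliary declaration `strain_trace` of the swirl–jet witness field (file 3/6) (NOGO N11 kill-all chain; search for candidate a priori estimates; no regularity claim). -/
theorem strain_trace (ξ : UnitAddTorus (Fin 3)) : (strain ξ).trace = 0 := by
  simp only [strain, Matrix.trace_fin_three, Matrix.of_apply, partialDeriv_fld, jac]
  simp
  ring

/-- **`det S ≡ 0`** for the witness (three cases: jet region, where the horizontal part is an
exact solid-body rotation; or one of the jet profiles and its derivative vanish). -/
theorem strain_det (ξ : UnitAddTorus (Fin 3)) : (strain ξ).det = 0 := by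
  simp only [strain, Matrix.det_fin_three, Matrix.of_apply, partialDeriv_fld, jac]
  simp
  set y := repr ξ
  by_cases hp : |pc y - 1 / 4| < 1 / 8
  · by_cases hq : |2 * qc y - 1 / 4| < 1 / 8
    · obtain ⟨h1, h0⟩ := core_of_jet hp hq
      rw [h1, h0]; ring
    · obtain ⟨h1, h0⟩ := A_dA_eq_zero_of_not hq
      rw [h1, h0]; ring
  · obtain ⟨h1, h0⟩ := A_dA_eq_zero_of_not hp
    rw [h1, h0]; ring

/-- **`λ₂(S) = 0` everywhere** for the witness. -/
theorem middle_eq_zero (ξ : UnitAddTorus (Fin 3)) (hx : (strain ξ).IsHermitian) :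
    hx.eigenvalues₀ (Fin.cast (Fintype.card_fin 3).symm 1) = 0 :=
  MiddleEigen.middle_eq_zero_of_det_eq_zero (Fintype.card_fin 3) (strain ξ) (strain_isSymm ξ)
    (strain_trace ξ) (strain_det ξ)


end KillAll

end Summit.NavierStokesRegularity.FunctionalMining

end
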